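import Literature.NumberTheory.GaloisCohomology.Howard2004.QuotCartesianReductionProofs
import HarnessLib

/-!
# `H¹` of an equivariant bijection is bijective; transport of the presented cartesian identity along such
# bijections (theorems only; no definition, no named fact, no `sorry`)

B. Howard, *The Heegner point Kolyvagin system*, Compositio Math. 140 (2004) (arXiv:1202.6340), Def. 1.1.3
(p. 5 L93–99): the objects `T/IT` of `Quot(T)` are determined up to their canonical isomorphism, and H.3 («`F`
cartesian on `Quot(T)`», p. 7 L65–67) is stated on them; in the tree an object is a PRESENTATION
(`IsQuotientBy`), and the same quotient `T^{(k)}/π^iT^{(k)}` of an Eisenstein level appears under several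
presentations — `modIdeal` over the level ring `A_{m,k}` (the presentations H.3 quantifies over) and the host level
of the `π`-adic refinement (`PiRefinementDatum.Level`, over `S_𝔮`) — related by `Γ_K`-equivariant additive
bijections that are linear for different rings.  This file supplies the ring-free transport (companion of
`QuotCartesianReductionProofs` §2, which treats the special case of two presentations of the same `IsQuotientBy`):

* `equivariant_symm_of_bijective`, **`bijective_cohomologyMap_of_bijective`** — `H¹(K_v, b)` is bijective for an
  equivariant additive bijection `b` (inverse = `H¹` of the inverse bijection);
* `AddSubgroup.map_eq_comap_map_iff_of_bijective` — subgroup algebra: the identity `L.map π_I = (L.map π_J).comap α`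
  is invariant under bijections `β_I`, `β_J` of the two targets compatible with `π_I, π_J, α` (private helper);
* **`map_cohomologyMap_eq_comap_iff_of_bijective`** — the same for the local `H¹` of equivariant module maps: the
  presented cartesian identity for `(T ↠ Q_I, T ↠ Q_J, α)` holds iff it holds for `(T ↠ Q'_I, T ↠ Q'_J, α')`
  whenever `Q_I → Q'_I`, `Q_J → Q'_J` are equivariant additive bijections with `β ∘ π = π'`, `α' ∘ β_I = β_J ∘ α`.

Everything is [folklore] functoriality of `H¹`, recorded against Howard's Def. 1.1.3 / H.3.  Cell `pub/bsd-print-x9`,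
shared μ-item of rows 9/10 (D1 road, `SatisfiesH.h3`); seat `bsd-line-x10b-p1-w6`.  BSD is not proved by any of this.
-/

set_option autoImplicit false

noncomputable section

open Function Field
open scoped ContRepresentation

namespace Literature.NumberTheory.GaloisCohomology.Howard2004

open Literature.NumberTheory.GaloisRepresentations
open Literature.NumberTheory.GaloisRepresentations.DiscreteGaloisModule

/-! ## §1 `H¹` of an equivariant additive bijection -/

section Bijective

variable {F : Type} [Field F]
  {N : Type} [AddCommGroup N] [TopologicalSpace N] [DiscreteTopology N]
  {N' : Type} [AddCommGroup N'] [TopologicalSpace N'] [DiscreteTopology N']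

/-- The inverse of an equivariant additive bijection is equivariant. [cite: SerreGaloisCohomology1997, Ch. I §2.2 (functoriality)] -/
theorem equivariant_symm_of_bijective (τ : DiscreteGaloisModule F N) (τ' : DiscreteGaloisModule F N')
    (b : N →+ N') (hb : ∀ (σ : absoluteGaloisGroup F) (x : N), b (τ σ x) = τ' σ (b x)) (hbij : Bijective b)
    (σ : absoluteGaloisGroup F) (y : N') :
    ((AddEquiv.ofBijective b hbij).symm : N' →+ N) (τ' σ y) =
      τ σ (((AddEquiv.ofBijective b hbij).symm : N' →+ N) y) := by
  apply hbij.1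
  change b ((AddEquiv.ofBijective b hbij).symm (τ' σ y)) = b (τ σ ((AddEquiv.ofBijective b hbij).symm y))
  rw [hb, AddEquiv.ofBijective_apply_symm_apply, AddEquiv.ofBijective_apply_symm_apply]

/-- **`H¹` of an equivariant additive bijection is bijective** (its inverse is `H¹` of the inverse bijection).
[cite: SerreGaloisCohomology1997, Ch. I §2.2 (functoriality of H¹ in the coefficients)] [cite: Howard2004HeegnerKolyvagin, Def. 1.1.3 (arXiv p. 5 L93–99: T/IT up to isomorphism)] -/
theorem bijective_cohomologyMap_of_bijective (τ : DiscreteGaloisModule F N) (τ' : DiscreteGaloisModule F N')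
    (b : N →+ N') (hb : ∀ (σ : absoluteGaloisGroup F) (x : N), b (τ σ x) = τ' σ (b x)) (hbij : Bijective b) :
    Bijective (ContinuousRep.cohomologyMap τ τ' b continuous_of_discreteTopology hb 1) := by
  have hb' : ∀ (σ : absoluteGaloisGroup F) (y : N'), ((AddEquiv.ofBijective b hbij).symm : N' →+ N) (τ' σ y) =
      τ σ (((AddEquiv.ofBijective b hbij).symm : N' →+ N) y) := equivariant_symm_of_bijective τ τ' b hb hbij
  have k1 : ∀ x, ContinuousRep.cohomologyMap τ' τ ((AddEquiv.ofBijective b hbij).symm : N' →+ N)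
      continuous_of_discreteTopology hb' 1
      (ContinuousRep.cohomologyMap τ τ' b continuous_of_discreteTopology hb 1 x) = x := fun x =>
    (cohomologyMap_one_comm_sq τ τ' τ τ b hb ((AddEquiv.ofBijective b hbij).symm : N' →+ N) hb'
      (AddMonoidHom.id N) (fun _ _ => rfl) (AddMonoidHom.id N) (fun _ _ => rfl)
      (fun x => (AddEquiv.ofBijective b hbij).symm_apply_apply x) x).trans
      ((cohomologyMap_id_apply _ _).trans (cohomologyMap_id_apply _ _))
  have k2 : ∀ y, ContinuousRep.cohomologyMap τ τ' b continuous_of_discreteTopology hb 1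
      (ContinuousRep.cohomologyMap τ' τ ((AddEquiv.ofBijective b hbij).symm : N' →+ N)
        continuous_of_discreteTopology hb' 1 y) = y := fun y =>
    (cohomologyMap_one_comm_sq τ' τ τ' τ' ((AddEquiv.ofBijective b hbij).symm : N' →+ N) hb' b hb
      (AddMonoidHom.id N') (fun _ _ => rfl) (AddMonoidHom.id N') (fun _ _ => rfl)
      (fun y => (AddEquiv.ofBijective b hbij).apply_symm_apply y) y).trans
      ((cohomologyMap_id_apply _ _).trans (cohomologyMap_id_apply _ _))
  exact ⟨LeftInverse.injective k1, RightInverse.surjective k2⟩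

end Bijective

/-! ## §2 Transport of the presented cartesian identity -/

section Transport

/-- Subgroup algebra (private helper): with `β_I`, `β_J` bijective, `π'_I = β_I ∘ π_I`, `π'_J = β_J ∘ π_J`,
`α' ∘ β_I = β_J ∘ α`, the identity `L.map π_I = (L.map π_J).comap α` holds iff the primed one does. [folklore] -/
private theorem map_eq_comap_map_iff_of_bijective {B QI QJ QI' QJ' : Type*} [AddCommGroup B] [AddCommGroup QI]
    [AddCommGroup QJ] [AddCommGroup QI'] [AddCommGroup QJ'] (L : AddSubgroup B)
    (πI : B →+ QI) (πJ : B →+ QJ) (α : QI →+ QJ) (πI' : B →+ QI') (πJ' : B →+ QJ') (α' : QI' →+ QJ')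
    (βI : QI →+ QI') (βJ : QJ →+ QJ') (hβI : Bijective βI) (hβJ : Bijective βJ)
    (h1 : ∀ x, βI (πI x) = πI' x) (h2 : ∀ x, βJ (πJ x) = πJ' x) (h3 : ∀ y, α' (βI y) = βJ (α y)) :
    L.map πI = (L.map πJ).comap α ↔ L.map πI' = (L.map πJ').comap α' := by
  -- both primed sides, pulled back along `β_I`, are the unprimed sides
  have eI : (L.map πI').comap βI = L.map πI := by
    ext y
    simp only [AddSubgroup.mem_comap, AddSubgroup.mem_map]
    constructor
    · rintro ⟨x, hx, hxy⟩
      exact ⟨x, hx, hβI.1 (by rw [h1, hxy])⟩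
    · rintro ⟨x, hx, rfl⟩
      exact ⟨x, hx, (h1 x).symm⟩
  have eJ : ((L.map πJ').comap α').comap βI = (L.map πJ).comap α := by
    ext y
    simp only [AddSubgroup.mem_comap, AddSubgroup.mem_map, h3]
    constructor
    · rintro ⟨x, hx, hxy⟩
      exact ⟨x, hx, hβJ.1 (by rw [h2, hxy])⟩
    · rintro ⟨x, hx, hxy⟩
      exact ⟨x, hx, by rw [← h2, hxy]⟩
  constructor
  · intro h
    -- `comap β_I` is injective on subgroups for `β_I` surjective
    have : ((L.map πI').comap βI).map βI = (((L.map πJ').comap α').comap βI).map βI := by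
      rw [eI, eJ, h]
    rwa [AddSubgroup.map_comap_eq_self_of_surjective hβI.2,
      AddSubgroup.map_comap_eq_self_of_surjective hβI.2] at this
  · intro h
    rw [← eI, ← eJ, h]

variable {F : Type} [Field F]
  {M : Type} [AddCommGroup M] [TopologicalSpace M] [DiscreteTopology M]
  {NI : Type} [AddCommGroup NI] [TopologicalSpace NI] [DiscreteTopology NI]
  {NJ : Type} [AddCommGroup NJ] [TopologicalSpace NJ] [DiscreteTopology NJ]
  {NI' : Type} [AddCommGroup NI'] [TopologicalSpace NI'] [DiscreteTopology NI']
  {NJ' : Type} [AddCommGroup NJ'] [TopologicalSpace NJ'] [DiscreteTopology NJ']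

/-- **Transport of the presented cartesian identity along equivariant bijections.**  Let `T ↠ Q_I`, `T ↠ Q_J`
and `T ↠ Q'_I`, `T ↠ Q'_J` be equivariant additive maps out of one module (two pairs of presentations of the same
two objects of `Quot(T)`), `α : Q_I → Q_J`, `α' : Q'_I → Q'_J` equivariant (the same `Quot`-morphism read twice),
and `β_I : Q_I → Q'_I`, `β_J : Q_J → Q'_J` equivariant additive BIJECTIONS with `β ∘ π = π'` and
`α' ∘ β_I = β_J ∘ α`.  Then for every `L ≤ H¹(K_v, T)`:
`L.map H¹(π_I) = (L.map H¹(π_J)).comap H¹(α)  ↔  L.map H¹(π'_I) = (L.map H¹(π'_J)).comap H¹(α')`.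
[cite: Howard2004HeegnerKolyvagin, Def. 1.1.2–1.1.3 and H.3 (arXiv p. 5 L88–99, p. 7 L65–67)] -/
theorem map_cohomologyMap_eq_comap_iff_of_bijective (τ : DiscreteGaloisModule F M)
    (τI : DiscreteGaloisModule F NI) (τJ : DiscreteGaloisModule F NJ)
    (τI' : DiscreteGaloisModule F NI') (τJ' : DiscreteGaloisModule F NJ')
    (πI : M →+ NI) (hπI : ∀ (σ : absoluteGaloisGroup F) (x : M), πI (τ σ x) = τI σ (πI x))
    (πJ : M →+ NJ) (hπJ : ∀ (σ : absoluteGaloisGroup F) (x : M), πJ (τ σ x) = τJ σ (πJ x))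
    (α : NI →+ NJ) (hα : ∀ (σ : absoluteGaloisGroup F) (x : NI), α (τI σ x) = τJ σ (α x))
    (πI' : M →+ NI') (hπI' : ∀ (σ : absoluteGaloisGroup F) (x : M), πI' (τ σ x) = τI' σ (πI' x))
    (πJ' : M →+ NJ') (hπJ' : ∀ (σ : absoluteGaloisGroup F) (x : M), πJ' (τ σ x) = τJ' σ (πJ' x))
    (α' : NI' →+ NJ') (hα' : ∀ (σ : absoluteGaloisGroup F) (x : NI'), α' (τI' σ x) = τJ' σ (α' x))
    (βI : NI →+ NI') (hβI : ∀ (σ : absoluteGaloisGroup F) (x : NI), βI (τI σ x) = τI' σ (βI x))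
    (hβIb : Bijective βI)
    (βJ : NJ →+ NJ') (hβJ : ∀ (σ : absoluteGaloisGroup F) (x : NJ), βJ (τJ σ x) = τJ' σ (βJ x))
    (hβJb : Bijective βJ)
    (h1 : ∀ x, βI (πI x) = πI' x) (h2 : ∀ x, βJ (πJ x) = πJ' x) (h3 : ∀ y, α' (βI y) = βJ (α y))
    (L : AddSubgroup (galoisCohomology τ 1)) :
    L.map (ContinuousRep.cohomologyMap τ τI πI continuous_of_discreteTopology hπI 1) =
        (L.map (ContinuousRep.cohomologyMap τ τJ πJ continuous_of_discreteTopology hπJ 1)).comap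
          (ContinuousRep.cohomologyMap τI τJ α continuous_of_discreteTopology hα 1) ↔
      L.map (ContinuousRep.cohomologyMap τ τI' πI' continuous_of_discreteTopology hπI' 1) =
        (L.map (ContinuousRep.cohomologyMap τ τJ' πJ' continuous_of_discreteTopology hπJ' 1)).comap
          (ContinuousRep.cohomologyMap τI' τJ' α' continuous_of_discreteTopology hα' 1) := by
  refine map_eq_comap_map_iff_of_bijective L _ _ _ _ _ _
    (ContinuousRep.cohomologyMap τI τI' βI continuous_of_discreteTopology hβI 1)
    (ContinuousRep.cohomologyMap τJ τJ' βJ continuous_of_discreteTopology hβJ 1)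
    (bijective_cohomologyMap_of_bijective τI τI' βI hβI hβIb)
    (bijective_cohomologyMap_of_bijective τJ τJ' βJ hβJ hβJb) (fun x => ?_) (fun x => ?_) (fun y => ?_)
  · exact (cohomologyMap_one_comm_sq τ τI τ τI' πI hπI βI hβI (AddMonoidHom.id M) (fun _ _ => rfl) πI' hπI'
      (fun m => h1 m) x).trans (congrArg _ (cohomologyMap_id_apply τ x))
  · exact (cohomologyMap_one_comm_sq τ τJ τ τJ' πJ hπJ βJ hβJ (AddMonoidHom.id M) (fun _ _ => rfl) πJ' hπJ'
      (fun m => h2 m) x).trans (congrArg _ (cohomologyMap_id_apply τ x))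
  · exact cohomologyMap_one_comm_sq τI τI' τJ τJ' βI hβI α' hα' α hα βJ hβJ h3 y

end Transport

end Literature.NumberTheory.GaloisCohomology.Howard2004

end
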